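import Summits.KontsevichZagierPeriods.KontsevichZagierPeriods.Theorems.RealOnePeriodRelations.Negative.GreenSound
import Summits.KontsevichZagierPeriods.KontsevichZagierPeriods.Theorems.RealOnePeriodRelations.Negative.Grading
import Summits.KontsevichZagierPeriods.KontsevichZagierPeriods.Theorems.RealOnePeriodRelations.Negative.CoherenceLocalArcs
import Summits.KontsevichZagierPeriods.KontsevichZagierPeriods.Theorems.PlanarCompiler.Negative.GreenTightness

/-!
# `RealOnePeriodRelations` (stmt-KontsevichZagierPeriods-10042) — negative side: load-bearing hypotheses of
# stubs of line `nash-retraction-thin-strip` (drefute, part 2 of 3)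

The picked line (`Cruxes/RealOnePeriodRelations/Lines/nash-retraction-thin-strip.lean`; reshape 2 replaced the
thin-strip coherence of reshape 1 by homotopy coherence through semialgebraic charts — cf. `Negative/CoherenceLocal`,
coherence is local) closes the crux from its stubs, none of which is false as typed (paper analysis in the seat's
notes). This file records, as kernel-checked negative lemmas, hypotheses / terms of three stubs that are LOAD-BEARING
(refuter-posited variants that are FALSE):

* §1 `stub_normalisation` (unchanged in content across reshapes; its inlined path / realisation predicates are
  `IsSAPath` / `Realises` of `Negative/CoherenceLocalArcs`): `c ∈ H₁` cannot be dropped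
  (`normalisation_false_without_H₁`, witness `[1]₀`, by the dimension grading `Negative/Grading`);
* §2 Green on the unit square (`stub_greenOnSquare`; reshape 2 concludes `[rB] + [rR] − [rT] − [rL] ∈ M₁`): the
  four-term shape is tight — keeping every hypothesis, adding `B(0,·) = 0` (which kills `[rL]` by 1b) and DROPPING
  the right-edge term `[rR]` gives a FALSE statement (`greenOnSquare_false_without_rightEdge`, polynomial data
  `S = ab`); equivalently, reshape 1's two-term form needed both vertical vanishing hypotheses;
* §3 `stub_exactDimOne` (unchanged): regularity of `u` up to the end points cannot be dropped
  (`exactDimOne_false_without_regularity`, the step `𝟙_{(0,∞)}`); continuity on `[0,1]` would suffice for the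
  value identity.
Bookkeeping lemmas (representations agreeing on their domain are congruent mod `M₁`, zero integrands) are the
landed `RealOnePeriodRelations.HomotopyInvariance.of_sub_of_mem_of_eqOn` / `of_mem_of_integrand_zero`
(`Theorems/SymplecticScissorsRealOnePeriodRelationsStubHomotopyInvarianceAux.lean`) and are not repeated here.
-/

noncomputable section

open scoped BigOperators Topology ComplexConjugate
open Set MeasureTheory Filter
open Literature.NumberTheory.Transcendental Literature.NumberTheory.Transcendental.CurvePeriods
open Literature.ModelTheory.ExponentialFields (IsSemialgebraic isSemialgebraic_setOf_eval_nonneg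
  isSemialgebraic_setOf_eval_le isSemialgebraic_setOf_eval_pos isSemialgebraic_setOf_eval_eq_zero)

namespace Summit.KontsevichZagierPeriods.SymplecticScissors.RealOnePeriodRelationsNegative.Stubs

/-! ## §1 `stub_normalisation`: the hypothesis `c ∈ H₁` is load-bearing -/

/-- `stub_normalisation` WITH THE HYPOTHESIS `c ∈ H₁` DELETED (refuter-posited deletion variant for
the load-bearing test). -/
def NormalisationWithoutH₁ : Prop :=
  ∀ c : KZ.FormalRep, ∃ (C : PeriodSymbol →₀ ℂ) (R : PeriodSymbol → KZ.IntegralRep 1),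
    (∀ s, IsAlgebraic ℚ (C s)) ∧ (∀ s ∈ C.support, IsSAPath s.γ.toFun) ∧
    (∀ s ∈ C.support, Realises (R s) (C s) s.ω s.γ.toFun) ∧
    evalCombination C = ((KZ.eval c : ℝ) : ℂ) ∧ c - ∑ s ∈ C.support, KZ.of (R s) ∈ M₁

/-- `c ∈ H₁` is load-bearing in `stub_normalisation`: for the dimension-zero constant `c = [1]₀`
no family of 1-dimensional realisations `R` has `c − Σ [R s] ∈ M₁`, because `M₁` is killed by the
dimension-zero evaluation `evalDim₀` (`Negative/Grading`) while `evalDim₀ c = 1`.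
[cite: KontsevichZagier2001, §1.2] -/
theorem normalisation_false_without_H₁ : ¬ NormalisationWithoutH₁ := by
  intro h
  obtain ⟨C, R, -, -, -, -, hmem⟩ := h (KZ.of (constRep₀ 1))
  have hker := M₁_le_ker_evalDim₀ hmem
  rw [AddMonoidHom.mem_ker, map_sub, map_sum] at hker
  simp [evalDim₀_of] at hker

/-! ## §2 `stub_greenOnSquare`: the four-term shape is tight — the right-edge term cannot be dropped -/

/-- The closed unit square `Q = [0,1]²`. [folklore] -/
def Q : Set (Fin 2 → ℝ) := {p | 0 ≤ p 0 ∧ p 0 ≤ 1 ∧ 0 ≤ p 1 ∧ p 1 ≤ 1}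

/-- `Q` is `ℚ`-semialgebraic. [folklore] -/
theorem isSemialgebraic_Q : IsSemialgebraic ℚ Q := by
  have h0 := isSemialgebraic_setOf_eval_nonneg (k := ℚ) (R := ℝ)
    (MvPolynomial.X (0 : Fin 2) : MvPolynomial (Fin 2) ℚ)
  have h1 := isSemialgebraic_setOf_eval_le (k := ℚ) (R := ℝ)
    (MvPolynomial.X (0 : Fin 2) : MvPolynomial (Fin 2) ℚ) 1
  have h2 := isSemialgebraic_setOf_eval_nonneg (k := ℚ) (R := ℝ)
    (MvPolynomial.X (1 : Fin 2) : MvPolynomial (Fin 2) ℚ)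
  have h3 := isSemialgebraic_setOf_eval_le (k := ℚ) (R := ℝ)
    (MvPolynomial.X (1 : Fin 2) : MvPolynomial (Fin 2) ℚ) 1
  have hQ : Q = (({x : Fin 2 → ℝ | 0 ≤ MvPolynomial.aeval x (MvPolynomial.X (0 : Fin 2) : MvPolynomial (Fin 2) ℚ)} ∩
      {x : Fin 2 → ℝ | MvPolynomial.aeval x (MvPolynomial.X (0 : Fin 2) : MvPolynomial (Fin 2) ℚ) ≤
        MvPolynomial.aeval x (1 : MvPolynomial (Fin 2) ℚ)}) ∩
      {x : Fin 2 → ℝ | 0 ≤ MvPolynomial.aeval x (MvPolynomial.X (1 : Fin 2) : MvPolynomial (Fin 2) ℚ)}) ∩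
      {x : Fin 2 → ℝ | MvPolynomial.aeval x (MvPolynomial.X (1 : Fin 2) : MvPolynomial (Fin 2) ℚ) ≤
        MvPolynomial.aeval x (1 : MvPolynomial (Fin 2) ℚ)} := by
    ext p
    simp [Q, and_assoc]
  rw [hQ]
  exact ((h0.inter h1).inter h2).inter h3

/-- Coordinate functions are `ℚ`-semialgebraic on `Q`. [folklore] -/
theorem isSemialgebraicFunOn_coord_Q (i : Fin 2) : IsSemialgebraicFunOn ℚ Q (fun p => p i) := by
  have h := isSemialgebraicFunOn_aeval isSemialgebraic_Q (MvPolynomial.X i : MvPolynomial (Fin 2) ℚ)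
  exact h.congr fun x _ => by simp

/-- Refuter-posited test variant of Green on the unit square (not a statement from the literature): the
hypotheses of `stub_greenOnSquare` (typed Green data `(A, B, S)` on the closed unit square), PLUS `B(0,·) = 0` on
`(0,1)` (so that the left-edge term `[rL]` of the reshape-2 conclusion `[rB] + [rR] − [rT] − [rL] ∈ M₁` dies by 1b),
with the right-edge term `[rR]` DROPPED from the conclusion: `[rB] − [rT] ∈ M₁`. (Against reshape 1's two-term
statement this is exactly the deletion of its hypothesis `B(1,·) = 0`.) `M₁` is the Kit's conclusion subgroup. -/
def GreenOnSquareWithoutRightEdge : Prop :=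
  ∀ (A B S : (Fin 2 → ℝ) → ℝ), IsSemialgebraicFunOn ℚ Q A → IsSemialgebraicFunOn ℚ Q B →
    ContinuousOn A Q → ContinuousOn B Q →
    (∀ p : Fin 2 → ℝ, 0 < p 0 → p 0 < 1 → 0 < p 1 → p 1 < 1 →
      HasFDerivAt S (A p • ContinuousLinearMap.proj (R := ℝ) (φ := fun _ : Fin 2 => ℝ) 0 +
        B p • ContinuousLinearMap.proj (R := ℝ) (φ := fun _ : Fin 2 => ℝ) 1) p) →
    (∀ t ∈ Set.Ioo (0 : ℝ) 1, B ![0, t] = 0) →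
    ∀ (rB rT : KZ.IntegralRep 1), rB.domain = {z | z 0 ∈ Set.Ioo (0 : ℝ) 1} →
      rT.domain = {z | z 0 ∈ Set.Ioo (0 : ℝ) 1} →
      (∀ z ∈ rB.domain, rB.integrand z = A ![z 0, 0]) → (∀ z ∈ rT.domain, rT.integrand z = A ![z 0, 1]) →
      KZ.of rB - KZ.of rT ∈ M₁

/-- `d(ab) = b da + a db` on the plane, in the typed shape of the Green generator. [folklore] -/
theorem hasFDerivAt_mul_coord (p : Fin 2 → ℝ) :
    HasFDerivAt (fun p : Fin 2 → ℝ => p 0 * p 1)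
      (p 1 • ContinuousLinearMap.proj (R := ℝ) (φ := fun _ : Fin 2 => ℝ) 0 +
        p 0 • ContinuousLinearMap.proj (R := ℝ) (φ := fun _ : Fin 2 => ℝ) 1) p := by
  have h0 := (ContinuousLinearMap.proj (R := ℝ) (φ := fun _ : Fin 2 => ℝ) 0).hasFDerivAt (x := p)
  have h1 := (ContinuousLinearMap.proj (R := ℝ) (φ := fun _ : Fin 2 => ℝ) 1).hasFDerivAt (x := p)
  have hmul : HasFDerivAt (fun p : Fin 2 → ℝ => p 0 * p 1) _ p := h0.mul h1
  refine hmul.congr_fderiv (ContinuousLinearMap.ext fun v => ?_)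
  change p 0 * v 1 + p 1 * v 0 = p 1 * v 0 + p 0 * v 1
  ring

/-- **The right-edge term of Green on the square cannot be dropped** (the four-term shape of
`stub_greenOnSquare` is tight; symmetrically for the left edge): the polynomial Green data `A = b`, `B = a`,
`S = ab` on `Q` satisfy every hypothesis and `B(0,·) = 0`, yet `[∫₀¹ A(t,0)] − [∫₀¹ A(t,1)] = [∫₀¹ 0] − [∫₀¹ 1]`
has value `−1` (the dropped right-edge term `[∫₀¹ B(1,t) dt] = [∫₀¹ 1]` carried it), so it is not in the sound
subgroup `M₁`. [cite: KontsevichZagier2001, §1.2] -/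
theorem greenOnSquare_false_without_rightEdge : ¬ GreenOnSquareWithoutRightEdge := by
  intro h
  have hmem := h (fun p => p 1) (fun p => p 0) (fun p => p 0 * p 1)
    (isSemialgebraicFunOn_coord_Q 1) (isSemialgebraicFunOn_coord_Q 0)
    (continuous_apply 1).continuousOn (continuous_apply 0).continuousOn
    (fun p _ _ _ _ => hasFDerivAt_mul_coord p)
    (fun t _ => by simp) (constRep₁ 0) (constRep₁ 1) rfl rfl
    (fun z _ => by simp) (fun z _ => by simp)
  have h0 := eval_eq_zero_of_mem_M₁ hmem
  rw [map_sub, KZ.eval_of, KZ.eval_of, value_constRep₁, value_constRep₁] at h0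
  norm_num at h0

/-! ## §3 `stub_exactDimOne`: regularity of `u` up to the end points is load-bearing -/

/-- `stub_exactDimOne` WITH THE HYPOTHESIS `ContDiffOn ℝ 1 u (Icc 0 1)` DELETED (refuter-posited
deletion variant for the load-bearing test). -/
def ExactDimOneWithoutRegularity : Prop :=
  ∀ (u : ℝ → ℝ), IsSemialgebraicFunOn ℚ {z : Fin 1 → ℝ | z 0 ∈ Set.Icc (0 : ℝ) 1} (fun z => u (z 0)) →
    ∀ (r r' : KZ.IntegralRep 1), r.domain = {z | z 0 ∈ Set.Ioo (0 : ℝ) 1} →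
      r'.domain = {z | z 0 ∈ Set.Ioo (0 : ℝ) 1} → (∀ z ∈ r.domain, r.integrand z = deriv u (z 0)) →
      (∀ z ∈ r'.domain, r'.integrand z = u 1 - u 0) → KZ.of r - KZ.of r' ∈ M₁

/-- The step `u = 𝟙_{(0, ∞)}`: semialgebraic, smooth on `(0,1]`, discontinuous at the end point `0`. [folklore] -/
def stepFun (t : ℝ) : ℝ := if t ≤ 0 then 0 else 1

/-- `stepFun` is `1` near every point of `(0, ∞)`. [folklore] -/
theorem stepFun_eventuallyEq_one {t : ℝ} (ht : 0 < t) : stepFun =ᶠ[𝓝 t] fun _ => (1 : ℝ) := by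
  filter_upwards [lt_mem_nhds ht] with s hs
  simp [stepFun, not_le.mpr hs]

/-- `deriv stepFun = 0` on `(0, ∞)`. [folklore] -/
theorem deriv_stepFun {t : ℝ} (ht : 0 < t) : deriv stepFun t = 0 := by
  rw [(stepFun_eventuallyEq_one ht).deriv_eq]
  simp

/-- The graph of `stepFun` over `[0,1]` is `ℚ`-semialgebraic (it is `0` on `[0,1] ∩ {t ≤ 0}` and `1`
on `[0,1] ∩ {t > 0}`). [folklore] -/
theorem isSemialgebraicFunOn_stepFun :
    IsSemialgebraicFunOn ℚ {z : Fin 1 → ℝ | z 0 ∈ Set.Icc (0 : ℝ) 1} (fun z => stepFun (z 0)) := by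
  have hT₁ : IsSemialgebraic ℚ (I01 ∩ {x : Fin 1 → ℝ |
      MvPolynomial.aeval x (MvPolynomial.X (0 : Fin 1) : MvPolynomial (Fin 1) ℚ) ≤
        MvPolynomial.aeval x (0 : MvPolynomial (Fin 1) ℚ)}) :=
    isSemialgebraic_I01.inter (isSemialgebraic_setOf_eval_le _ _)
  have hT₂ : IsSemialgebraic ℚ (I01 ∩ {x : Fin 1 → ℝ |
      0 < MvPolynomial.aeval x (MvPolynomial.X (0 : Fin 1) : MvPolynomial (Fin 1) ℚ)}) :=
    isSemialgebraic_I01.inter (isSemialgebraic_setOf_eval_pos _)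
  have h₁ : IsSemialgebraicFunOn ℚ (I01 ∩ {x : Fin 1 → ℝ |
      MvPolynomial.aeval x (MvPolynomial.X (0 : Fin 1) : MvPolynomial (Fin 1) ℚ) ≤
        MvPolynomial.aeval x (0 : MvPolynomial (Fin 1) ℚ)}) (fun z => stepFun (z 0)) := by
    refine (isSemialgebraicFunOn_aeval hT₁ 0).congr ?_
    intro x hx
    have hx0 : x 0 ≤ 0 := by simpa using hx.2
    simp [stepFun, hx0]
  have h₂ : IsSemialgebraicFunOn ℚ (I01 ∩ {x : Fin 1 → ℝ |
      0 < MvPolynomial.aeval x (MvPolynomial.X (0 : Fin 1) : MvPolynomial (Fin 1) ℚ)})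
      (fun z => stepFun (z 0)) := by
    refine (isSemialgebraicFunOn_aeval hT₂ 1).congr ?_
    intro x hx
    have hx0 : 0 < x 0 := by simpa using hx.2
    simp [stepFun, not_le.mpr hx0]
  have hU : (I01 ∩ {x : Fin 1 → ℝ |
      MvPolynomial.aeval x (MvPolynomial.X (0 : Fin 1) : MvPolynomial (Fin 1) ℚ) ≤
        MvPolynomial.aeval x (0 : MvPolynomial (Fin 1) ℚ)}) ∪
      (I01 ∩ {x : Fin 1 → ℝ | 0 < MvPolynomial.aeval x (MvPolynomial.X (0 : Fin 1) : MvPolynomial (Fin 1) ℚ)}) =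
      {z : Fin 1 → ℝ | z 0 ∈ Set.Icc (0 : ℝ) 1} := by
    ext x
    simp only [mem_union, mem_inter_iff, mem_setOf_eq, MvPolynomial.aeval_X, map_zero, I01]
    constructor
    · rintro (h | h) <;> exact h.1
    · intro h
      rcases le_or_gt (x 0) 0 with h' | h'
      exacts [Or.inl ⟨h, h'⟩, Or.inr ⟨h, h'⟩]
  rw [← hU]
  exact Summit.KontsevichZagierPeriods.SymplecticScissors.PlanarCompilerNegative.isSemialgebraicFunOn_union h₁ h₂

/-- Regularity of `u` UP TO THE END POINTS is load-bearing in `stub_exactDimOne`: for the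
semialgebraic step `u = 𝟙_{(0,∞)}` (smooth on `(0,1]`, jump at `t = 0`), `deriv u = 0` on `(0,1)` while
`u 1 − u 0 = 1`, so `[∫₀¹ u′] − [∫₀¹ (u 1 − u 0)] = [∫₀¹ 0] − [∫₀¹ 1]` has value `−1 ≠ 0` and is not in
the sound subgroup `M₁`. (Continuity on `[0,1]` would already give the VALUE identity — continuous
semialgebraic functions are absolutely continuous — so `ContDiffOn ℝ 1` is more than the value level
needs; the move-level proof by rule 2 on monotonicity pieces also only needs `u` continuous on `[0,1]`
and `C¹` on the open pieces.) [cite: KontsevichZagier2001, §1.2] -/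
theorem exactDimOne_false_without_regularity : ¬ ExactDimOneWithoutRegularity := by
  intro h
  have hmem := h stepFun isSemialgebraicFunOn_stepFun (constRep₁ 0) (constRep₁ 1) rfl rfl
    (fun z hz => by
      have hz' : 0 < z 0 := by
        have : z ∈ unitDom := hz
        exact this.1
      simp [deriv_stepFun hz'])
    (fun z _ => by norm_num [stepFun])
  have h0 := eval_eq_zero_of_mem_M₁ hmem
  rw [map_sub, KZ.eval_of, KZ.eval_of, value_constRep₁, value_constRep₁] at h0
  norm_num at h0

end Summit.KontsevichZagierPeriods.SymplecticScissors.RealOnePeriodRelationsNegative.Stubs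

end
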